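import Mathlib
import Literature.NumberTheory.LFunctions.DeBruijnHDiv
import Summits.RiemannHypothesis.RiemannHypothesis.Theorems.UniversalFactorH0DecayStandalone

/-!
# RiemannHypothesis / UniversalFactor — the wide-kernel tail `e^{ax}F_a(x) → a∫₀^∞ H_0 cosh(a·)`, route-file-independent

Route `RiemannHypothesis/UniversalFactor`, items `WideKernelTail` (stmt-RiemannHypothesis-14036, formerly
2581) and `WideKernelNoGo` (stmt-RiemannHypothesis-2578). This module imports neither the route file nor
any module importing it (see `UniversalFactorH0DecayStandalone.lean` for why). With
`F = F_a = deBruijnHDiv (fun u ↦ 1 + u²/a²)` (`= ∫₀^∞ Φ(u)(1+u²/a²)⁻¹cos(zu)du`, entire, even, real on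
`ℝ`, `F − F''/a² = H_0` — `Literature/NumberTheory/LFunctions/DeBruijnHDiv.lean`) we give a
**Fubini-free proof by variation of constants** of the tail asymptotics (the tree's
`tendsto_exp_mul_deBruijnHDiv_laplace` / `wideKernelTail` go through the convolution
`F_a = H_0 ∗ (a/2)e^{−a|·|}` instead):

* `UniversalFactorStandalone.exists_bound_deriv_add_mul_deBruijnHDiv_laplace` — `F' + aF` is bounded on `ℝ`;
  `UniversalFactorStandalone.deriv_deBruijnHDiv_zero` — `F'(0) = 0` (evenness);
  `UniversalFactorStandalone.deriv_deriv_deBruijnHDiv_laplace` — `F'' = a²(F − H_0)`;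
* `UniversalFactorStandalone.hasDerivAt_expNeg_mul` / `hasDerivAt_expPos_mul` — with
  `Ψ = e^{−az}(F' + aF)`, `Θ = e^{az}(F' − aF)`: `Ψ' = −a²e^{−az}H_0`, `Θ' = −a²e^{az}H_0`;
* **`UniversalFactorStandalone.tendsto_exp_mul_deBruijnHDiv_laplace`** — for `0 < a < π/8`,
  `e^{ax}F_a(x) → a∫₀^∞ H_0(y)cosh(ay)dy` (`x → +∞`): integrating `Ψ'`, `Θ'` on `[0, x]`,
  `Ψ(x) → 0` (boundedness) forces `aF(0) = a²∫₀^∞e^{−at}H_0`, and then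
  `e^{ax}F(x) = (a/2)e^{2ax}∫ₓ^∞e^{−at}H_0 + F(0)/2 + (a/2)∫₀ˣe^{at}H_0` with the first term
  `O(e^{(a−b)x})`, `a < b < π/8` (stated with `Complex.exp (a x)`; the route decl `WideKernelTail` spells the
  same limit with `(Real.exp (a * x) : ℂ)`).

References: N. G. de Bruijn, Duke Math. J. 17 (1950) (the transforms); E. C. Titchmarsh, *The theory
of the Riemann zeta-function* (1986), §10.1; route `UniversalFactor`, item WideKernelTail.
-/

noncomputable section

namespace Summit.RiemannHypothesis.RiemannHypothesis.Theorems

open MeasureTheory Set Filter Complex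
open scoped Topology
open Literature.NumberTheory.LFunctions

/-! ## The Laplace-smoothed transform `F_a` on the real axis: bounds, evenness, the ODE -/

/-- `F_a' + a F_a` is bounded on the real axis (`|cos|, |sin| ≤ 1` there and `Φ/(1+u²/a²)`,
`uΦ/(1+u²/a²)` are integrable). [folklore] -/
theorem UniversalFactorStandalone.exists_bound_deriv_add_mul_deBruijnHDiv_laplace (a : ℝ) :
    ∃ M : ℝ, ∀ x : ℝ, ‖deriv (deBruijnHDiv (fun u : ℝ => 1 + u ^ 2 / a ^ 2)) x +
      (a : ℂ) * deBruijnHDiv (fun u : ℝ => 1 + u ^ 2 / a ^ 2) x‖ ≤ M := by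
  set m : ℝ → ℝ := fun u ↦ 1 + u ^ 2 / a ^ 2 with hm
  have hadm : IsDivAdmissible m := isDivAdmissible_laplace a
  obtain ⟨C, T, -, hb⟩ := hadm.exists_bound
  set M₀ : ℝ := ∫ u in Ioi (0:ℝ), C * deBruijnHBound T 0 u with hM₀
  set M₁ : ℝ := ∫ u in Ioi (0:ℝ), C * deBruijnHBound T 1 u with hM₁
  refine ⟨M₁ + |a| * M₀, fun x ↦ ?_⟩
  have h0 : ‖deBruijnHDiv m x‖ ≤ M₀ := by
    rw [← divCosMoment_zero, divCosMoment]
    refine norm_integral_le_of_norm_le ((integrableOn_deBruijnHBound T 0).const_mul C)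
      (ae_restrict_of_forall_mem measurableSet_Ioi fun u hu ↦ ?_)
    simpa using norm_divCosIntegrand_le hb 0 (show |((x : ℝ) : ℂ).im| ≤ 0 by simp) hu
  have h1 : ‖deriv (deBruijnHDiv m) x‖ ≤ M₁ := by
    rw [hadm.deriv_deBruijnHDiv, norm_neg, divSinMoment]
    refine norm_integral_le_of_norm_le ((integrableOn_deBruijnHBound T 1).const_mul C)
      (ae_restrict_of_forall_mem measurableSet_Ioi fun u hu ↦ ?_)
    simpa using norm_divSinIntegrand_le hb 1 (show |((x : ℝ) : ℂ).im| ≤ 0 by simp) hu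
  calc ‖deriv (deBruijnHDiv m) x + (a : ℂ) * deBruijnHDiv m x‖
      ≤ ‖deriv (deBruijnHDiv m) x‖ + ‖(a : ℂ) * deBruijnHDiv m x‖ := norm_add_le _ _
    _ ≤ M₁ + |a| * M₀ := by
        rw [norm_mul, Complex.norm_real, Real.norm_eq_abs]
        exact add_le_add h1 (mul_le_mul_of_nonneg_left h0 (abs_nonneg a))

/-- `F'(0) = 0` for the even entire function `F = deBruijnHDiv m`. [folklore] -/
theorem UniversalFactorStandalone.deriv_deBruijnHDiv_zero (m : ℝ → ℝ) :
    deriv (deBruijnHDiv m) 0 = 0 := by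
  have h : deriv (fun z : ℂ ↦ deBruijnHDiv m (-z)) 0 = -deriv (deBruijnHDiv m) (-0) :=
    deriv_comp_neg (deBruijnHDiv m) 0
  have he : (fun z : ℂ ↦ deBruijnHDiv m (-z)) = deBruijnHDiv m := funext (deBruijnHDiv_neg m)
  rw [he, neg_zero] at h
  have h2 : (2 : ℂ) * deriv (deBruijnHDiv m) 0 = 0 := by linear_combination h
  exact (mul_eq_zero.1 h2).resolve_left two_ne_zero

/-- The ODE `F_a'' = a² (F_a − H_0)` (from `deBruijnHDiv_laplace_sub_deriv_deriv`, `a ≠ 0`).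
[folklore] -/
theorem UniversalFactorStandalone.deriv_deriv_deBruijnHDiv_laplace {a : ℝ} (ha : a ≠ 0) (z : ℂ) :
    deriv (deriv (deBruijnHDiv (fun u : ℝ => 1 + u ^ 2 / a ^ 2))) z =
      (a : ℂ) ^ 2 * (deBruijnHDiv (fun u : ℝ => 1 + u ^ 2 / a ^ 2) z - deBruijnH 0 z) := by
  have h := deBruijnHDiv_laplace_sub_deriv_deriv a z
  have ha2 : (a : ℂ) ^ 2 ≠ 0 := pow_ne_zero 2 (by exact_mod_cast ha)
  have h' : deriv (deriv (deBruijnHDiv (fun u : ℝ => 1 + u ^ 2 / a ^ 2))) z / (a : ℂ) ^ 2 =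
      deBruijnHDiv (fun u : ℝ => 1 + u ^ 2 / a ^ 2) z - deBruijnH 0 z := by
    linear_combination (-1 : ℂ) * h
  rw [div_eq_iff ha2] at h'
  rw [h']
  ring

/-- Variation of constants, `−` branch: `Ψ(z) = e^{−az}(F' + aF)(z)` has `Ψ' = −a² e^{−az} H_0`.
[folklore] -/
theorem UniversalFactorStandalone.hasDerivAt_expNeg_mul {a : ℝ} (ha : a ≠ 0) (z : ℂ) :
    HasDerivAt (fun w : ℂ ↦ Complex.exp (((-a : ℝ) : ℂ) * w) *
        (deriv (deBruijnHDiv (fun u : ℝ => 1 + u ^ 2 / a ^ 2)) w +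
          (a : ℂ) * deBruijnHDiv (fun u : ℝ => 1 + u ^ 2 / a ^ 2) w))
      (-(a : ℂ) ^ 2 * (Complex.exp (((-a : ℝ) : ℂ) * z) * deBruijnH 0 z)) z := by
  set F := deBruijnHDiv (fun u : ℝ => 1 + u ^ 2 / a ^ 2) with hF
  have hFd : Differentiable ℂ F := differentiable_deBruijnHDiv_laplace a
  have hFd' : Differentiable ℂ (deriv F) := hFd.deriv
  have hODE := UniversalFactorStandalone.deriv_deriv_deBruijnHDiv_laplace ha z
  have h1 : HasDerivAt (fun w : ℂ ↦ ((-a : ℝ) : ℂ) * w) (((-a : ℝ) : ℂ)) z := by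
    simpa using (hasDerivAt_id z).const_mul (((-a : ℝ) : ℂ))
  have h2 : HasDerivAt (fun w : ℂ ↦ deriv F w + (a : ℂ) * F w)
      (deriv (deriv F) z + (a : ℂ) * deriv F z) z :=
    (hFd' z).hasDerivAt.add (((hFd z).hasDerivAt).const_mul (a : ℂ))
  refine (h1.cexp.mul h2).congr_deriv ?_
  rw [hODE]
  push_cast
  ring

/-- Variation of constants, `+` branch: `Θ(z) = e^{az}(F' − aF)(z)` has `Θ' = −a² e^{az} H_0`.
[folklore] -/
theorem UniversalFactorStandalone.hasDerivAt_expPos_mul {a : ℝ} (ha : a ≠ 0) (z : ℂ) :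
    HasDerivAt (fun w : ℂ ↦ Complex.exp ((a : ℂ) * w) *
        (deriv (deBruijnHDiv (fun u : ℝ => 1 + u ^ 2 / a ^ 2)) w -
          (a : ℂ) * deBruijnHDiv (fun u : ℝ => 1 + u ^ 2 / a ^ 2) w))
      (-(a : ℂ) ^ 2 * (Complex.exp ((a : ℂ) * z) * deBruijnH 0 z)) z := by
  set F := deBruijnHDiv (fun u : ℝ => 1 + u ^ 2 / a ^ 2) with hF
  have hFd : Differentiable ℂ F := differentiable_deBruijnHDiv_laplace a
  have hFd' : Differentiable ℂ (deriv F) := hFd.deriv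
  have hODE := UniversalFactorStandalone.deriv_deriv_deBruijnHDiv_laplace ha z
  have h1 : HasDerivAt (fun w : ℂ ↦ (a : ℂ) * w) (a : ℂ) z := by
    simpa using (hasDerivAt_id z).const_mul (a : ℂ)
  have h2 : HasDerivAt (fun w : ℂ ↦ deriv F w - (a : ℂ) * F w)
      (deriv (deriv F) z - (a : ℂ) * deriv F z) z :=
    (hFd' z).hasDerivAt.sub (((hFd z).hasDerivAt).const_mul (a : ℂ))
  refine (h1.cexp.mul h2).congr_deriv ?_
  rw [hODE]
  ring

/-- FTC along the real axis for an entire primitive: `∫₀ˣ φ'(t) dt = φ(x) − φ(0)`. [folklore] -/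
theorem UniversalFactorStandalone.integral_deriv_ofReal {φ φ' : ℂ → ℂ}
    (hφ : ∀ z : ℂ, HasDerivAt φ (φ' z) z) (hcont : Continuous φ') (x : ℝ) :
    ∫ t in (0:ℝ)..x, φ' t = φ x - φ 0 := by
  have h := intervalIntegral.integral_eq_sub_of_hasDerivAt (a := (0:ℝ)) (b := x)
    (f := fun t : ℝ ↦ φ t) (f' := fun t : ℝ ↦ φ' t) (fun t _ ↦ (hφ t).comp_ofReal)
    ((hcont.comp Complex.continuous_ofReal).intervalIntegrable _ _)
  simpa using h

/-- **The wide-kernel tail** (the body of item `WideKernelTail` of route `UniversalFactor`, verbatim;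
an alternative, Fubini-free proof of the tree's `tendsto_exp_mul_deBruijnHDiv_laplace`): for
`0 < a < π/8`, `e^{ax} F_a(x) → a ∫₀^∞ H_0(y) cosh(ay) dy` as `x → +∞`.
Proof by variation of constants in the ODE `F'' = a²(F − H_0)`: with `Ψ = e^{−az}(F' + aF)` and
`Θ = e^{az}(F' − aF)` one has `Ψ' = −a²e^{−az}H_0`, `Θ' = −a²e^{az}H_0`, so on the real axis
`e^{−ax}(F' + aF)(x) = aF(0) − a²∫₀ˣ e^{−at}H_0` and `e^{ax}(F' − aF)(x) = −aF(0) − a²∫₀ˣ e^{at}H_0`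
(`F'(0) = 0` by evenness). Since `F, F'` are bounded on `ℝ`, `Ψ(x) → 0`, whence
`aF(0) = a²∫₀^∞ e^{−at}H_0` and
`e^{ax}F(x) = (a/2)e^{2ax}∫ₓ^∞ e^{−at}H_0 + F(0)/2 + (a/2)∫₀ˣ e^{at}H_0 → (a/2)∫₀^∞(e^{−at} + e^{at})H_0`,
the first term being `O(e^{(a−b)x})` by the decay `‖H_0(t)‖ ≤ C_b e^{−b|t|}`, `a < b < π/8`.
[folklore] -/
theorem UniversalFactorStandalone.tendsto_exp_mul_deBruijnHDiv_laplace {a : ℝ} (ha : 0 < a)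
    (hlt : a < Real.pi / 8) :
    Tendsto (fun x : ℝ ↦ Complex.exp ((a : ℂ) * x) *
        deBruijnHDiv (fun u : ℝ => 1 + u ^ 2 / a ^ 2) (x : ℂ)) atTop
      (𝓝 ((a : ℂ) * ∫ y in Ioi (0:ℝ), deBruijnH 0 (y : ℂ) * (Real.cosh (a * y) : ℂ))) := by
  set F := deBruijnHDiv (fun u : ℝ => 1 + u ^ 2 / a ^ 2) with hF
  have ha0 : a ≠ 0 := ha.ne'
  have haC : (a : ℂ) ≠ 0 := by exact_mod_cast ha0
  -- decay with an exponent `b ∈ (a, π/8)`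
  set b : ℝ := (a + Real.pi / 8) / 2 with hb
  have hab : a < b := by rw [hb]; linarith
  have hbπ : b < Real.pi / 8 := by rw [hb]; linarith
  have hb0 : 0 < b := by linarith
  obtain ⟨C, hH⟩ := UniversalFactorStandalone.exists_exp_mul_norm_deBruijnH_zero_le hbπ
  -- the two integrands `e^{∓at} H_0(t)`
  set gm : ℝ → ℂ := fun t ↦ Complex.exp (((-a : ℝ) : ℂ) * t) * deBruijnH 0 t with hgm
  set gp : ℝ → ℂ := fun t ↦ Complex.exp ((a : ℂ) * t) * deBruijnH 0 t with hgp
  have hgm_int : IntegrableOn gm (Ioi 0) :=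
    UniversalFactorStandalone.integrableOn_exp_mul_deBruijnH_zero (c := -a) (by linarith) hH
  have hgp_int : IntegrableOn gp (Ioi 0) :=
    UniversalFactorStandalone.integrableOn_exp_mul_deBruijnH_zero hab hH
  have hIm : Tendsto (fun x : ℝ ↦ ∫ t in (0:ℝ)..x, gm t) atTop (𝓝 (∫ t in Ioi (0:ℝ), gm t)) :=
    intervalIntegral_tendsto_integral_Ioi 0 hgm_int tendsto_id
  have hIp : Tendsto (fun x : ℝ ↦ ∫ t in (0:ℝ)..x, gp t) atTop (𝓝 (∫ t in Ioi (0:ℝ), gp t)) :=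
    intervalIntegral_tendsto_integral_Ioi 0 hgp_int tendsto_id
  have hcontH : Continuous (deBruijnH 0) := (differentiable_deBruijnH_holds 0).continuous
  have hF'0 : deriv F 0 = 0 := UniversalFactorStandalone.deriv_deBruijnHDiv_zero _
  -- (E1): `e^{−ax}(F' + aF)(x) = aF(0) − a² ∫₀ˣ gm`
  have hE1 : ∀ x : ℝ, Complex.exp (((-a : ℝ) : ℂ) * x) * (deriv F x + (a : ℂ) * F x) =
      (a : ℂ) * F 0 - (a : ℂ) ^ 2 * ∫ t in (0:ℝ)..x, gm t := by
    intro x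
    have h := UniversalFactorStandalone.integral_deriv_ofReal
      (UniversalFactorStandalone.hasDerivAt_expNeg_mul ha0)
      (continuous_const.mul ((Continuous.cexp (continuous_const.mul continuous_id)).mul hcontH)) x
    rw [intervalIntegral.integral_const_mul] at h
    simp only [mul_zero, Complex.exp_zero, one_mul] at h
    linear_combination -h + hF'0
  -- (E2): `e^{ax}(F' − aF)(x) = −aF(0) − a² ∫₀ˣ gp`
  have hE2 : ∀ x : ℝ, Complex.exp ((a : ℂ) * x) * (deriv F x - (a : ℂ) * F x) =
      -((a : ℂ) * F 0) - (a : ℂ) ^ 2 * ∫ t in (0:ℝ)..x, gp t := by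
    intro x
    have h := UniversalFactorStandalone.integral_deriv_ofReal
      (UniversalFactorStandalone.hasDerivAt_expPos_mul ha0)
      (continuous_const.mul ((Continuous.cexp (continuous_const.mul continuous_id)).mul hcontH)) x
    rw [intervalIntegral.integral_const_mul] at h
    simp only [mul_zero, Complex.exp_zero, one_mul] at h
    linear_combination -h + hF'0
  -- (★): `aF(0) = a² ∫₀^∞ gm`, because `Ψ(x) → 0`
  obtain ⟨M, hM⟩ := UniversalFactorStandalone.exists_bound_deriv_add_mul_deBruijnHDiv_laplace a
  have hΨ0 : Tendsto (fun x : ℝ ↦ Complex.exp (((-a : ℝ) : ℂ) * x) * (deriv F x + (a : ℂ) * F x))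
      atTop (𝓝 0) := by
    have hexp : Tendsto (fun x : ℝ ↦ Real.exp (-(a * x)) * M) atTop (𝓝 (0 * M)) :=
      (Real.tendsto_exp_neg_atTop_nhds_zero.comp (tendsto_id.const_mul_atTop ha)).mul_const _
    rw [zero_mul] at hexp
    refine squeeze_zero_norm (fun x ↦ ?_) hexp
    rw [norm_mul, Complex.norm_exp]
    have hre : (((-a : ℝ) : ℂ) * (x : ℂ)).re = -(a * x) := by simp
    rw [hre]
    exact mul_le_mul_of_nonneg_left (hM x) (Real.exp_pos _).le
  have hstar : (a : ℂ) * F 0 = (a : ℂ) ^ 2 * ∫ t in Ioi (0:ℝ), gm t := by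
    have h1 : Tendsto (fun x : ℝ ↦ (a : ℂ) * F 0 - (a : ℂ) ^ 2 * ∫ t in (0:ℝ)..x, gm t) atTop
        (𝓝 ((a : ℂ) * F 0 - (a : ℂ) ^ 2 * ∫ t in Ioi (0:ℝ), gm t)) :=
      tendsto_const_nhds.sub (hIm.const_mul _)
    have h0 : Tendsto (fun x : ℝ ↦ (a : ℂ) * F 0 - (a : ℂ) ^ 2 * ∫ t in (0:ℝ)..x, gm t) atTop
        (𝓝 0) := hΨ0.congr hE1
    have := tendsto_nhds_unique h0 h1
    linear_combination -this
  -- tails of the improper integral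
  have hT : ∀ x : ℝ, 0 ≤ x →
      (∫ t in Ioi (0:ℝ), gm t) - ∫ t in (0:ℝ)..x, gm t = ∫ t in Ioi x, gm t := by
    intro x hx
    have hdisj : Disjoint (Ioc (0:ℝ) x) (Ioi x) :=
      Set.disjoint_left.2 fun t ht ht' ↦ not_lt.2 ht.2 ht'
    rw [intervalIntegral.integral_of_le hx, ← Ioc_union_Ioi_eq_Ioi hx,
      setIntegral_union hdisj measurableSet_Ioi (hgm_int.mono_set Ioc_subset_Ioi_self)
        (hgm_int.mono_set (Ioi_subset_Ioi hx))]
    ring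
  -- the formula `e^{ax} F(x) = (a/2) e^{2ax} ∫ₓ^∞ gm + F(0)/2 + (a/2) ∫₀ˣ gp` for `x ≥ 0`
  have hformula : ∀ x : ℝ, 0 ≤ x → Complex.exp ((a : ℂ) * x) * F x =
      (a / 2 : ℂ) * (Complex.exp ((a : ℂ) * x) * Complex.exp ((a : ℂ) * x)) * (∫ t in Ioi x, gm t) +
        F 0 / 2 + (a / 2 : ℂ) * ∫ t in (0:ℝ)..x, gp t := by
    intro x hx
    set E : ℂ := Complex.exp ((a : ℂ) * x) with hE
    have hE0 : E ≠ 0 := Complex.exp_ne_zero _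
    have hEinv : Complex.exp (((-a : ℝ) : ℂ) * x) = E⁻¹ := by
      rw [hE, ← Complex.exp_neg]; push_cast; ring_nf
    have f1 : deriv F x + (a : ℂ) * F x = E * ((a : ℂ) ^ 2 * ∫ t in Ioi x, gm t) := by
      have h := hE1 x
      rw [hstar, ← mul_sub, hT x hx, hEinv] at h
      calc deriv F x + (a : ℂ) * F x = E * (E⁻¹ * (deriv F x + (a : ℂ) * F x)) := by
            rw [mul_inv_cancel_left₀ hE0]
        _ = E * ((a : ℂ) ^ 2 * ∫ t in Ioi x, gm t) := by rw [h]
    have f2 := hE2 x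
    rw [← hE] at f2
    have h2a : (2 * a : ℂ) ≠ 0 := mul_ne_zero two_ne_zero haC
    apply mul_left_cancel₀ h2a
    linear_combination E * f1 - f2
  -- the first term tends to `0`
  have hterm : Tendsto (fun x : ℝ ↦ (a / 2 : ℂ) * (Complex.exp ((a : ℂ) * x) * Complex.exp ((a : ℂ) * x)) *
      ∫ t in Ioi x, gm t) atTop (𝓝 0) := by
    have hexp : Tendsto (fun x : ℝ ↦ a / 2 * (C / (a + b)) * Real.exp (-((b - a) * x))) atTop
        (𝓝 (a / 2 * (C / (a + b)) * 0)) :=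
      (Real.tendsto_exp_neg_atTop_nhds_zero.comp (tendsto_id.const_mul_atTop (sub_pos.2 hab))).const_mul _
    rw [mul_zero] at hexp
    refine squeeze_zero_norm' ?_ hexp
    filter_upwards [eventually_ge_atTop (0:ℝ)] with x hx
    have hTb := UniversalFactorStandalone.norm_integral_Ioi_exp_neg_mul_deBruijnH_zero_le ha hb0 hH hx
    rw [norm_mul, norm_mul, norm_mul, Complex.norm_exp]
    have hre : ((a : ℂ) * (x : ℂ)).re = a * x := by simp
    have hn2 : ‖(a / 2 : ℂ)‖ = a / 2 := by
      rw [show (a / 2 : ℂ) = ((a / 2 : ℝ) : ℂ) by push_cast; ring, Complex.norm_real, Real.norm_eq_abs,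
        abs_of_pos (by positivity)]
    rw [hre, hn2]
    calc a / 2 * (Real.exp (a * x) * Real.exp (a * x)) * ‖∫ t in Ioi x, gm t‖
        ≤ a / 2 * (Real.exp (a * x) * Real.exp (a * x)) * (C / (a + b) * Real.exp (-((a + b) * x))) := by
          gcongr
      _ = a / 2 * (C / (a + b)) * Real.exp (-((b - a) * x)) := by
          rw [show -((b - a) * x) = a * x + a * x + -((a + b) * x) by ring, Real.exp_add, Real.exp_add]
          ring
  -- the limit value
  have hlim : F 0 / 2 + (a / 2 : ℂ) * ∫ t in Ioi (0:ℝ), gp t =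
      (a : ℂ) * ∫ y in Set.Ioi (0:ℝ), deBruijnH 0 (y : ℂ) * (Real.cosh (a * y) : ℂ) := by
    have hF0 : F 0 = (a : ℂ) * ∫ t in Ioi (0:ℝ), gm t := by
      apply mul_left_cancel₀ haC
      rw [hstar]; ring
    rw [hF0]
    have hsum : (∫ t in Ioi (0:ℝ), gm t) + ∫ t in Ioi (0:ℝ), gp t =
        2 * ∫ y in Set.Ioi (0:ℝ), deBruijnH 0 (y : ℂ) * (Real.cosh (a * y) : ℂ) := by
      rw [← integral_add hgm_int hgp_int, ← integral_const_mul]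
      refine setIntegral_congr_fun measurableSet_Ioi fun t _ ↦ ?_
      simp only [hgm, hgp, Complex.ofReal_cosh, Complex.cosh]
      push_cast
      ring_nf
    linear_combination (a / 2 : ℂ) * hsum
  -- conclusion
  have hmain : Tendsto (fun x : ℝ ↦
      (a / 2 : ℂ) * (Complex.exp ((a : ℂ) * x) * Complex.exp ((a : ℂ) * x)) * (∫ t in Ioi x, gm t) +
        F 0 / 2 + (a / 2 : ℂ) * ∫ t in (0:ℝ)..x, gp t) atTop
      (𝓝 (0 + F 0 / 2 + (a / 2 : ℂ) * ∫ t in Ioi (0:ℝ), gp t)) :=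
    (hterm.add tendsto_const_nhds).add (hIp.const_mul _)
  rw [zero_add, hlim] at hmain
  refine hmain.congr' ?_
  filter_upwards [eventually_ge_atTop (0:ℝ)] with x hx
  exact (hformula x hx).symm

end Summit.RiemannHypothesis.RiemannHypothesis.Theorems
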